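import Summits.HodgeConjecture.HodgeConjecture.Cruxes.BlochSeedDiscOne.PhaseTorusBoxLaw
import Summits.HodgeConjecture.HodgeConjecture.Cruxes.BlochSeedDiscOne.LinePhaseTorus

/-!
# BAND BOX LAW: the μ-lattice for EVERY (A1)-clean axial design — line or band, any height, rank, door (control g6, 2026-08-29)

Nothing here proves HC, HC_AV, HC_CM, H2 or 18881; census-neutral; no fact, no instance, no notation.  SORRY-FREE target.
Pen proof + data (14∕14 band designs + 41∕41 line designs of record): `Cruxes/BlochSeedDiscOne/BOX-LAW-g6.md` §9.

§1 TORUS LEVEL (general mass).  `PhaseTorus.boxLaw` assumed ALL clean moments vanish, including the mass `ω̂(0)`.  For band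
alphabets the mass `M₀ = N(cccc)` is not zero, so here the frequency-`0` term is kept:
`boxLaw'` — `32 · N(s) = 2 · (Σ_τ ω τ) − Re(e(−Σ s) · μ)` whenever `moment ω k = 0` for every clean `k ≠ 0`.

§2 DESIGN LEVEL (the SMEARED dictionary).  A cell with AXIAL letters (`β_f` on a coordinate axis or zero — every letter of every
`◇_h`) and charges `c_f = h − α_f`, moduli `b_f = |β_f|`, band defects `d_f = c_f − b_f`, is sent to the product measure
`⊗_f (b_f · δ_{τ_f} + (d_f ∕ 4) · 𝟙)` on `(μ₄)⁴`; its torus moments at frequencies without a `2` are EXACTLY the design moments in the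
letters `c, β, β̄` (`omegaB_moment`), so (A1) ⇒ clean off `{0, ±(1,1,1,1)}` by the alphabet-free `moment_eq_zero_of_beta`
(`omegaB_clean`), mass `= N(cccc) = M₀` (`omegaB_mass`), top moment `= μ` (`omegaB_top`), and `16 ·` box mass `= W(s)`, the signed count
`W(s) = Σ ν ∏_f (2 b_f [τ_f ∈ {s_f, s_f+1}] + d_f)` (`omegaB_boxSum`).  Hence
* `axialDesign_mu_eq`   — `μ = ⟨2 (M₀ − W(0)), 2 (M₀ − W(e₀))⟩` for every integer (A1)-clean axial design;
* `axialDesign_mu_dvd`  — if every band defect is EVEN (automatic in `◇_h` for even `h`): `16 ∣ re μ`, `16 ∣ im μ`,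
  `32 ∣ re μ − im μ` (i.e. `μ ∈ 16(1+i)·ℤ[i]`) and `8 ∣ M₀`;
* `diamondDesign_mu_dvd` — the same for every integer (A1)-clean design supported in `◇_h`, `h` even.
On the LINE (`d_f = 0`, `M₀ = 0` by the Ψ-row) this is `lineDesign_mu_eq_boxCounts` (`μ ∈ 32ℤ[i]`) again.
-/

namespace Summit.HodgeConjecture.HodgeConjecture.Cruxes.BlochSeedDiscOne.PhaseTorus

open Finset BigOperators

/-! ## §1 torus level: the box law with general mass -/

theorem coefBox_zero (s : ZMod 4) : coefBox s 0 = 1 / 2 := by simp [coefBox]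

theorem prod_svec_zero_univ (s : PT) : ∏ f, svec Finset.univ s f 0 = 1 / 16 := by
  have h : ∀ f, svec Finset.univ s f 0 = 1 / 2 := fun f => by simp [svec, coefBox_zero]
  simp_rw [h]
  rw [Finset.prod_const, Finset.card_univ, Fintype.card_fin]
  norm_num

theorem moment_zero_eq_sum (ω : PT → ℝ) : moment ω 0 = ((∑ τ, ω τ : ℝ) : ℂ) := by
  unfold moment
  push_cast
  refine Finset.sum_congr rfl fun τ _ => ?_
  rw [show chi 0 τ = 1 from by simp [chi]]
  ring

/-- the three-term reduction of the box pairing when only the NON-ZERO clean moments vanish. -/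
theorem box_pairing' (ω : PT → ℝ) (hK : ∀ k, KAdm k → k ≠ 0 → moment ω k = 0) (s : PT) :
    ((boxSum ω s : ℝ) : ℂ) = (1 / 16 : ℂ) * ((∑ τ, ω τ : ℝ) : ℂ) +
      ((∏ f, svec Finset.univ s f 1) * moment ω (fun _ => 1) +
        (starRingEnd ℂ) ((∏ f, svec Finset.univ s f 1) * moment ω (fun _ => 1))) := by
  have hS := pairing_expansion ω (svec Finset.univ s)
  set b := svec Finset.univ s with hb
  have h01 : (0 : PT) ≠ (fun _ => (1 : ZMod 4)) := fun h => absurd (congr_fun h 0) (by decide)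
  have h03 : (0 : PT) ≠ (fun _ => (3 : ZMod 4)) := fun h => absurd (congr_fun h 0) (by decide)
  have h13 : (fun _ => (1 : ZMod 4) : PT) ≠ (fun _ => 3) := fun h => absurd (congr_fun h 0) (by decide)
  have hred : ∑ k : PT, (∏ f, b f (k f)) * moment ω k =
      (∏ f, b f ((0 : PT) f)) * moment ω 0 + ((∏ f, b f 1) * moment ω (fun _ => 1) +
        (∏ f, b f 3) * moment ω (fun _ => 3)) := by
    have hsub : ∑ k : PT, (∏ f, b f (k f)) * moment ω k =
        ∑ k ∈ ({(0 : PT), (fun _ => 1), (fun _ => 3)} : Finset PT), (∏ f, b f (k f)) * moment ω k := by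
      symm
      refine Finset.sum_subset (Finset.subset_univ _) fun k _ hk => ?_
      simp only [Finset.mem_insert, Finset.mem_singleton, not_or] at hk
      by_cases h : ∃ f, k f = 2
      · obtain ⟨f, hf⟩ := h
        rw [Finset.prod_eq_zero (Finset.mem_univ f) (by rw [hf, hb, svec_two]), zero_mul]
      · rw [hK k ⟨fun f hf => h ⟨f, hf⟩, hk.2.1, hk.2.2⟩ hk.1, mul_zero]
    rw [hsub, Finset.sum_insert (by simp [h01, h03]), Finset.sum_insert (by simp [h13]), Finset.sum_singleton]
  have hc3 : ∏ f, b f 3 = (starRingEnd ℂ) (∏ f, b f 1) := by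
    rw [map_prod]; exact Finset.prod_congr rfl fun f _ => by rw [hb, svec_three]
  have hc0 : ∏ f, b f ((0 : PT) f) = 1 / 16 := by
    simp only [Pi.zero_apply]; rw [hb, prod_svec_zero_univ]
  rw [hred, hc3, moment_three_eq_conj_moment_one, ← map_mul, hc0, moment_zero_eq_sum] at hS
  have hreal : ∑ τ : PT, (ω τ : ℂ) * ∏ f, (∑ j : ZMod 4, b f j * Complex.I ^ ((j * τ f).val)) =
      ((∑ τ : PT, ω τ * ∏ f, uvec Finset.univ s f (τ f) : ℝ) : ℂ) := by
    push_cast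
    refine Finset.sum_congr rfl fun τ _ => ?_
    congr 1
    exact Finset.prod_congr rfl fun f _ => by rw [hb]; exact trig_svec Finset.univ s f (τ f)
  rw [hreal, ← slabSum_eq_pairing, ← pbox_eq_slab_univ] at hS
  rw [boxSum]
  exact hS

/-- **BOX LAW with mass**: `32 · N(s) = 2 · (Σ_τ ω τ) − Re(e(−Σ s) · μ)` for every real measure whose non-zero clean moments vanish. -/
theorem boxLaw' (ω : PT → ℝ) (hK : ∀ k, KAdm k → k ≠ 0 → moment ω k = 0) (s : PT) :
    32 * boxSum ω s = 2 * (∑ τ, ω τ) - (e (-∑ f, s f) * moment ω (fun _ => 1)).re := by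
  have h := box_pairing' ω hK s
  rw [prod_svec_one_univ, Complex.add_conj,
    show (1 / 16 : ℂ) * ((∑ τ, ω τ : ℝ) : ℂ) = (((1 / 16 : ℝ) * ∑ τ, ω τ : ℝ) : ℂ) by push_cast; ring,
    ← Complex.ofReal_add] at h
  have h' := Complex.ofReal_injective h
  have hP : (-(e (-∑ f, s f)) / 64 * moment ω (fun _ => 1)).re = -(1 / 64) * (e (-∑ f, s f) * moment ω (fun _ => 1)).re := by
    rw [show -(e (-∑ f, s f)) / 64 * moment ω (fun _ => 1) = ((-(1 / 64) : ℝ) : ℂ) * (e (-∑ f, s f) * moment ω (fun _ => 1)) by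
      push_cast; ring, Complex.re_ofReal_mul]
  rw [hP] at h'
  linarith

end Summit.HodgeConjecture.HodgeConjecture.Cruxes.BlochSeedDiscOne.PhaseTorus

namespace Summit.HodgeConjecture.HodgeConjecture.Cruxes.BlochSeedDiscOne.BandPhaseTorus

open Finset BigOperators Summit.Ventures.HSemireg Summit.Ventures.HSemireg.Pad4Tower
open LinePhaseTorus (lineCharge betaG mletter wordOf tau phaseOf upE unitG TopWord lineLetter LineCell)

/-! ## §2a axial letters: `(a, b·ζ_k)` — every letter of every `◇_h` -/

/-- the axial letter of level `a`, modulus `b`, phase `k` (`lineLetter h c k = axLetter (h − c) c k`). -/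
def axLetter (a : ℤ) (b : ℕ) (k : Fin 4) : BPoint := (a, (b : ℤ) * ![1, 0, -1, 0] k, (b : ℤ) * ![0, -1, 0, 1] k)

/-- a cell all of whose letters are axial. -/
def AxCell (Z : MCell) : Prop := ∀ f, ∃ a : ℤ, ∃ b : ℕ, ∃ k : Fin 4, Z f = axLetter a b k

/-- `b_f = |β_f|` (the ℓ¹ form, = the modulus on an axial letter). -/
def babs (Z : MCell) (f : Fin 4) : ℤ := |(Z f).2.1| + |(Z f).2.2|

/-- the BAND DEFECT `d_f = c_f − b_f` (`c_f = h − α_f`; `0` on the LINE). -/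
def defect (h : ℤ) (Z : MCell) (f : Fin 4) : ℤ := lineCharge h Z f - babs Z f

theorem babs_of_eq {Z : MCell} {f : Fin 4} {a : ℤ} {b : ℕ} {k : Fin 4} (hZ : Z f = axLetter a b k) : babs Z f = b := by
  unfold babs; rw [hZ]; fin_cases k <;> simp [axLetter]

theorem betaG_of_eq_ax {Z : MCell} {f : Fin 4} {a : ℤ} {b : ℕ} {k : Fin 4} (hZ : Z f = axLetter a b k) :
    betaG Z f = (b : GaussianInt) * unitG k := by
  rw [betaG, hZ, Zsqrtd.ext_iff]
  simp [axLetter, unitG]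

theorem phaseOf_axLetter (a : ℤ) {b : ℕ} (hb : 0 < b) (k : Fin 4) : phaseOf (axLetter a b k) = k := by
  have hb' : (0 : ℤ) < b := by exact_mod_cast hb
  have hb0 : b ≠ 0 := hb.ne'
  fin_cases k <;> simp [phaseOf, axLetter, hb0, not_lt.mpr hb'.le]

/-- a letter with `β` on an axis or zero IS an axial letter. -/
theorem exists_axLetter_of_axis (x : BPoint) (hx : x.2.1 = 0 ∨ x.2.2 = 0) :
    ∃ a : ℤ, ∃ b : ℕ, ∃ k : Fin 4, x = axLetter a b k := by
  obtain ⟨a, re, im⟩ := x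
  simp only at hx
  rcases hx with h0 | h0 <;> subst h0
  · -- re = 0: β = i·im
    by_cases him : 0 ≤ im
    · refine ⟨a, im.toNat, 3, ?_⟩; simp [axLetter, Int.toNat_of_nonneg him]
    · refine ⟨a, (-im).toNat, 1, ?_⟩; simp [axLetter, Int.toNat_of_nonneg (by omega : (0:ℤ) ≤ -im)]
  · by_cases hre : 0 ≤ re
    · refine ⟨a, re.toNat, 0, ?_⟩; simp [axLetter, Int.toNat_of_nonneg hre]
    · refine ⟨a, (-re).toNat, 2, ?_⟩; simp [axLetter, Int.toNat_of_nonneg (by omega : (0:ℤ) ≤ -re)]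

theorem axCell_of_axis {Z : MCell} (hZ : ∀ f, (Z f).2.1 = 0 ∨ (Z f).2.2 = 0) : AxCell Z :=
  fun f => exists_axLetter_of_axis (Z f) (hZ f)

/-- LINE cells are axial. -/
theorem axCell_of_lineCell {h : ℤ} {Z : MCell} (hZ : LineCell h Z) : AxCell Z := fun f => by
  obtain ⟨c, k, e⟩ := hZ f
  exact ⟨h - c, c, k, by rw [e]; rfl⟩

/-! ## §2b the letters in `ℂ`: `β_f = b_f · e(τ_f)` -/

theorem toComplex_betaG_ax {Z : MCell} (hZ : AxCell Z) (f : Fin 4) :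
    ((betaG Z f : GaussianInt) : ℂ) = (babs Z f : ℂ) * upE (tau Z f) := by
  obtain ⟨a, b, k, e⟩ := hZ f
  rw [betaG_of_eq_ax e, babs_of_eq e, map_mul, map_natCast, LinePhaseTorus.toComplex_unitG]
  push_cast
  rcases Nat.eq_zero_or_pos b with h0 | hpos
  · simp [h0]
  · congr 1
    simp only [tau, e, phaseOf_axLetter a hpos k]

theorem toComplex_star_betaG_ax {Z : MCell} (hZ : AxCell Z) (f : Fin 4) :
    ((star (betaG Z f) : GaussianInt) : ℂ) = (babs Z f : ℂ) * upE (3 * tau Z f) := by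
  rw [GaussianInt.toComplex_star, toComplex_betaG_ax hZ f, map_mul, map_intCast, LinePhaseTorus.upE_three_mul_neg]

/-- the letter read by `k_f ∈ {0,1,3}`: `c_f` at `0`, `b_f e(k_f τ_f)` at `1, 3`. -/
noncomputable def letterC (h : ℤ) (Z : MCell) (f : Fin 4) (j : ZMod 4) : ℂ :=
  if j = 0 then (lineCharge h Z f : ℂ) else (babs Z f : ℂ) * upE (j * tau Z f)

theorem toComplex_mletter_wordOf_ax {h : ℤ} {Z : MCell} (hZ : AxCell Z) (k : Fin 4 → ZMod 4) (f : Fin 4)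
    (hk : k f ≠ 2) : ((mletter h Z f (wordOf k f) : GaussianInt) : ℂ) = letterC h Z f (k f) := by
  have h4 : ∀ y : ZMod 4, y = 0 ∨ y = 1 ∨ y = 2 ∨ y = 3 := by decide
  unfold letterC
  rcases h4 (k f) with e | e | e | e
  · rw [LinePhaseTorus.wordOf_apply_zero e, e, if_pos rfl]
    simp [mletter]
  · rw [LinePhaseTorus.wordOf_apply_one e, e, if_neg (by decide), one_mul]
    simp only [mletter, Matrix.cons_val_two, Matrix.tail_cons, Matrix.head_cons]
    exact toComplex_betaG_ax hZ f
  · exact absurd e hk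
  · rw [LinePhaseTorus.wordOf_apply_three e, e, if_neg (by decide)]
    simp only [mletter, Matrix.cons_val_three, Matrix.tail_cons, Matrix.head_cons]
    exact toComplex_star_betaG_ax hZ f

theorem toComplex_mono_wordOf_ax {h : ℤ} {Z : MCell} (hZ : AxCell Z) (k : Fin 4 → ZMod 4) (hk : ∀ f, k f ≠ 2) :
    ((LinePhaseTorus.MCell.mono h Z (wordOf k) : GaussianInt) : ℂ) = ∏ f, letterC h Z f (k f) := by
  unfold LinePhaseTorus.MCell.mono
  rw [map_prod]
  exact Finset.prod_congr rfl fun f _ => toComplex_mletter_wordOf_ax hZ k f (hk f)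

/-! ## §2c the SMEARED measure of a design and its Fourier transform -/

/-- the smeared weight of factor `f` of the cell `Z` at phase `u`: `b_f [u = τ_f] + d_f ∕ 4`. -/
noncomputable def wt (h : ℤ) (Z : MCell) (f : Fin 4) (u : ZMod 4) : ℝ :=
  (babs Z f : ℝ) * (if u = tau Z f then 1 else 0) + (defect h Z f : ℝ) / 4

/-- the SMEARED phase measure of an integer design (product weights per cell, signed multiplicities `m_N, −m_P`). -/
noncomputable def omegaB (h : ℤ) (C : MConfig) (mN mP : MCell → ℤ) (t : Fin 4 → ZMod 4) : ℝ :=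
  (∑ Z ∈ C.lower, (mN Z : ℝ) * ∏ f, wt h Z f (t f)) - ∑ P ∈ C.upper, (mP P : ℝ) * ∏ f, wt h P f (t f)

theorem charSum_e (j : ZMod 4) : ∑ u : ZMod 4, PhaseTorus.e (j * u) = if j = 0 then 4 else 0 :=
  PhaseTorus.charSum_u4 j

/-- one factor's Fourier transform: `Σ_u wt(u) e(j u) = letterC j` for `j ≠ 2`. -/
theorem wt_transform {h : ℤ} (Z : MCell) (f : Fin 4) (j : ZMod 4) (hj : j ≠ 2) :
    ∑ u : ZMod 4, (wt h Z f u : ℂ) * PhaseTorus.e (j * u) = letterC h Z f j := by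
  have hsplit : ∑ u : ZMod 4, (wt h Z f u : ℂ) * PhaseTorus.e (j * u) =
      (babs Z f : ℂ) * PhaseTorus.e (j * tau Z f) + ((defect h Z f : ℂ) / 4) * ∑ u : ZMod 4, PhaseTorus.e (j * u) := by
    have hw : ∀ u, (wt h Z f u : ℂ) * PhaseTorus.e (j * u) =
        (babs Z f : ℂ) * (if u = tau Z f then PhaseTorus.e (j * u) else 0) + ((defect h Z f : ℂ) / 4) * PhaseTorus.e (j * u) := by
      intro u; unfold wt; split_ifs <;> push_cast <;> ring
    simp_rw [hw]
    rw [Finset.sum_add_distrib, ← Finset.mul_sum, ← Finset.mul_sum, Finset.sum_ite_eq' Finset.univ (tau Z f)]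
    simp
  rw [hsplit, charSum_e]
  unfold letterC
  by_cases h0 : j = 0
  · subst h0
    rw [if_pos rfl, if_pos rfl, zero_mul, PhaseTorus.e_zero, mul_one]
    unfold defect; push_cast; ring
  · rw [if_neg h0, if_neg h0, mul_zero, add_zero]
    rfl

/-- Fubini for a product weight over the torus. -/
theorem sum_prod_wt_chi {h : ℤ} (Z : MCell) (k : Fin 4 → ZMod 4) :
    ∑ t : Fin 4 → ZMod 4, (∏ f, (wt h Z f (t f) : ℂ)) * PhaseTorus.chi k t =
      ∏ f, ∑ u : ZMod 4, (wt h Z f u : ℂ) * PhaseTorus.e (k f * u) := by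
  simp_rw [PhaseTorus.chi_eq_prod_e, ← Finset.prod_mul_distrib]
  rw [Finset.prod_univ_sum]
  simp only [Fintype.piFinset_univ]

/-- **dictionary**: the torus moments of the smeared measure are the design moments (frequencies without a `2`). -/
theorem omegaB_moment (h : ℤ) (C : MConfig) (mN mP : MCell → ℤ) (hax : ∀ Z ∈ C.lower ∪ C.upper, AxCell Z)
    (k : Fin 4 → ZMod 4) (hk : ∀ f, k f ≠ 2) :
    PhaseTorus.moment (omegaB h C mN mP) k = ((LinePhaseTorus.moment h C mN mP (wordOf k) : GaussianInt) : ℂ) := by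
  classical
  have hL : ∀ Z ∈ C.lower, AxCell Z := fun Z hZ => hax Z (Finset.mem_union_left _ hZ)
  have hU : ∀ P ∈ C.upper, AxCell P := fun P hP => hax P (Finset.mem_union_right _ hP)
  have hcell : ∀ Z, AxCell Z → ∑ t : Fin 4 → ZMod 4, (∏ f, (wt h Z f (t f) : ℂ)) * PhaseTorus.chi k t =
      ((LinePhaseTorus.MCell.mono h Z (wordOf k) : GaussianInt) : ℂ) := fun Z hZ => by
    rw [sum_prod_wt_chi, toComplex_mono_wordOf_ax hZ k hk]
    exact Finset.prod_congr rfl fun f _ => wt_transform Z f (k f) (hk f)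
  unfold PhaseTorus.moment omegaB LinePhaseTorus.moment
  push_cast
  simp_rw [sub_mul, Finset.sum_mul, Finset.sum_sub_distrib]
  rw [Finset.sum_comm, Finset.sum_comm (s := Finset.univ) (t := C.upper)]
  simp_rw [mul_assoc, ← Finset.mul_sum]
  rw [map_sub, map_sum, map_sum]
  congr 1
  · refine Finset.sum_congr rfl fun Z hZ => ?_
    rw [hcell Z (hL Z hZ), zsmul_eq_mul, map_mul, map_intCast]
  · refine Finset.sum_congr rfl fun P hP => ?_
    rw [hcell P (hU P hP), zsmul_eq_mul, map_mul, map_intCast]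

/-- **(A1) ⇒ the smeared measure is clean off `{0, ±(1,1,1,1)}`** (alphabet-free: `moment_eq_zero_of_beta`). -/
theorem omegaB_clean (h : ℤ) (C : MConfig) (mN mP : MCell → ℤ) (hax : ∀ Z ∈ C.lower ∪ C.upper, AxCell Z)
    (hA1 : ClassScreen (C.wch mN mP)) (k : Fin 4 → ZMod 4) (hk : PhaseTorus.KAdm k) (hk0 : k ≠ 0) :
    PhaseTorus.moment (omegaB h C mN mP) k = 0 := by
  obtain ⟨hk2, hk1, hk3⟩ := hk
  obtain ⟨f, hf⟩ : ∃ f, k f ≠ 0 := by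
    by_contra hc; push_neg at hc; exact hk0 (funext hc)
  have h4 : ∀ y : ZMod 4, y = 0 ∨ y = 1 ∨ y = 2 ∨ y = 3 := by decide
  have hwf : wordOf k f = 2 ∨ wordOf k f = 3 := by
    rcases h4 (k f) with e | e | e | e
    · exact absurd e hf
    · exact Or.inl (LinePhaseTorus.wordOf_apply_one e)
    · exact absurd e (hk2 f)
    · exact Or.inr (LinePhaseTorus.wordOf_apply_three e)
  rw [omegaB_moment h C mN mP hax k hk2, LinePhaseTorus.moment_eq_zero_of_beta h C mN mP hA1 (wordOf k) hwf
    (LinePhaseTorus.wordOf_ne hk2 (Or.inl ⟨rfl, rfl⟩) hk1) (LinePhaseTorus.wordOf_ne hk2 (Or.inr ⟨rfl, rfl⟩) hk3), map_zero]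

/-- the MASS `M₀ = N(cccc) = Σ ν ∏_f c_f` of a design. -/
def mass (h : ℤ) (C : MConfig) (mN mP : MCell → ℤ) : ℤ :=
  (∑ Z ∈ C.lower, mN Z * ∏ f, lineCharge h Z f) - ∑ P ∈ C.upper, mP P * ∏ f, lineCharge h P f

theorem moment_cccc_eq_mass (h : ℤ) (C : MConfig) (mN mP : MCell → ℤ) :
    LinePhaseTorus.moment h C mN mP (fun _ => 1) = (mass h C mN mP : GaussianInt) := by
  unfold LinePhaseTorus.moment mass
  push_cast
  simp_rw [LinePhaseTorus.mono_one, zsmul_eq_mul]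
  push_cast
  rfl

theorem wordOf_zero : wordOf (0 : Fin 4 → ZMod 4) = fun _ => 1 := by
  funext f; exact LinePhaseTorus.wordOf_apply_zero rfl

/-- **mass**: `Σ_t ω̃(t) = M₀`. -/
theorem omegaB_mass (h : ℤ) (C : MConfig) (mN mP : MCell → ℤ) (hax : ∀ Z ∈ C.lower ∪ C.upper, AxCell Z) :
    ∑ t, omegaB h C mN mP t = (mass h C mN mP : ℝ) := by
  have h0 := omegaB_moment h C mN mP hax 0 (fun f => by rw [Pi.zero_apply]; decide)
  rw [PhaseTorus.moment_zero_eq_sum, wordOf_zero, moment_cccc_eq_mass] at h0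
  have h1 : (((∑ t, omegaB h C mN mP t : ℝ)) : ℂ) = ((mass h C mN mP : ℝ) : ℂ) := by
    rw [h0]; simp [GaussianInt.toComplex_def₂]
  exact_mod_cast h1

/-- **top**: the top torus moment of `ω̃` is `μ = wch(eeee)`. -/
theorem omegaB_top (h : ℤ) (C : MConfig) (mN mP : MCell → ℤ) (hax : ∀ Z ∈ C.lower ∪ C.upper, AxCell Z) :
    PhaseTorus.moment (omegaB h C mN mP) (fun _ => 1) = ((C.wch mN mP eWord : GaussianInt) : ℂ) := by
  rw [omegaB_moment h C mN mP hax (fun _ => 1) (fun _ => by decide), LinePhaseTorus.wordOf_one,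
    LinePhaseTorus.wch_eWord_eq_moment_beta h]

/-! ## §2d box masses of the smeared measure: `16 · N(s) = W(s)` -/

/-- the indicator of the phase pair `{s, s+1}`. -/
def pairI (s u : ZMod 4) : ℤ := if u = s ∨ u = s + 1 then 1 else 0

/-- `W(s) = Σ ν ∏_f (2 b_f [τ_f ∈ {s_f, s_f+1}] + d_f)` — an INTEGER for an integer design. -/
def W (h : ℤ) (C : MConfig) (mN mP : MCell → ℤ) (s : Fin 4 → ZMod 4) : ℤ :=
  (∑ Z ∈ C.lower, mN Z * ∏ f, (2 * babs Z f * pairI (s f) (tau Z f) + defect h Z f)) -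
    ∑ P ∈ C.upper, mP P * ∏ f, (2 * babs P f * pairI (s f) (tau P f) + defect h P f)

theorem wt_pair_sum {h : ℤ} (Z : MCell) (f : Fin 4) (s : ZMod 4) :
    wt h Z f s + wt h Z f (s + 1) = ((2 * babs Z f * pairI s (tau Z f) + defect h Z f : ℤ) : ℝ) / 2 := by
  unfold wt pairI
  have hne : s + 1 ≠ s := PhaseTorus.succ_ne_self4 s
  by_cases h1 : tau Z f = s
  · rw [if_pos h1.symm, if_neg (by rw [h1]; exact hne), if_pos (Or.inl h1)]; push_cast; ring
  · by_cases h2 : tau Z f = s + 1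
    · rw [if_neg (Ne.symm h1), if_pos h2.symm, if_pos (Or.inr h2)]; push_cast; ring
    · rw [if_neg (Ne.symm h1), if_neg (Ne.symm h2), if_neg (not_or.mpr ⟨h1, h2⟩)]; push_cast; ring

theorem pbox_eq_piFinset (s : Fin 4 → ZMod 4) :
    PhaseTorus.pbox s = Fintype.piFinset fun f => ({s f, s f + 1} : Finset (ZMod 4)) := by
  ext t
  rw [PhaseTorus.mem_pbox, Fintype.mem_piFinset]
  simp only [Finset.mem_insert, Finset.mem_singleton]

/-- Fubini over a box for one cell's product weight. -/
theorem sum_pbox_prod_wt {h : ℤ} (Z : MCell) (s : Fin 4 → ZMod 4) :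
    ∑ t ∈ PhaseTorus.pbox s, ∏ f, wt h Z f (t f) =
      ((∏ f, (2 * babs Z f * pairI (s f) (tau Z f) + defect h Z f) : ℤ) : ℝ) / 16 := by
  rw [pbox_eq_piFinset, ← Finset.prod_univ_sum]
  have hf : ∀ f, ∑ u ∈ ({s f, s f + 1} : Finset (ZMod 4)), wt h Z f u =
      ((2 * babs Z f * pairI (s f) (tau Z f) + defect h Z f : ℤ) : ℝ) / 2 := fun f => by
    rw [Finset.sum_pair (PhaseTorus.succ_ne_self4 (s f)).symm, wt_pair_sum]
  simp_rw [hf]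
  rw [Finset.prod_div_distrib, Finset.prod_const, Finset.card_univ, Fintype.card_fin]
  push_cast
  norm_num

/-- **box masses**: `16 · boxSum ω̃ s = W(s)`. -/
theorem omegaB_boxSum (h : ℤ) (C : MConfig) (mN mP : MCell → ℤ) (s : Fin 4 → ZMod 4) :
    16 * PhaseTorus.boxSum (omegaB h C mN mP) s = (W h C mN mP s : ℝ) := by
  unfold PhaseTorus.boxSum omegaB W
  rw [Finset.sum_sub_distrib, Finset.sum_comm, Finset.sum_comm (s := PhaseTorus.pbox s) (t := C.upper)]
  simp_rw [← Finset.mul_sum, sum_pbox_prod_wt]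
  push_cast
  rw [mul_sub, Finset.mul_sum, Finset.mul_sum]
  congr 1 <;> refine Finset.sum_congr rfl fun x _ => ?_ <;> ring

/-! ## §2e THE BAND BOX LAW at design level and the lattice `16(1+i)ℤ[i]` -/

/-- **BAND BOX LAW**: `μ = ⟨2(M₀ − W(0)), 2(M₀ − W(e₀))⟩` for every integer (A1)-clean AXIAL design
(any alphabet — line or band —, height, support, rank, multiplicities, signs; no flow, no Hall, no orbit-constancy). -/
theorem axialDesign_mu_eq (h : ℤ) (C : MConfig) (mN mP : MCell → ℤ)
    (hax : ∀ Z ∈ C.lower ∪ C.upper, AxCell Z) (hA1 : ClassScreen (C.wch mN mP)) :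
    C.wch mN mP eWord =
      ⟨2 * (mass h C mN mP - W h C mN mP 0), 2 * (mass h C mN mP - W h C mN mP (Pi.single 0 1))⟩ := by
  set ω := omegaB h C mN mP with hω
  have hK : ∀ k, PhaseTorus.KAdm k → k ≠ 0 → PhaseTorus.moment ω k = 0 :=
    fun k hk hk0 => omegaB_clean h C mN mP hax hA1 k hk hk0
  have h0 := PhaseTorus.boxLaw' ω hK 0
  have h1 := PhaseTorus.boxLaw' ω hK (Pi.single 0 1)
  simp only [Pi.zero_apply, Finset.sum_const_zero, neg_zero, PhaseTorus.e_zero, one_mul] at h0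
  rw [PhaseTorus.sum_single_zero_one, PhaseTorus.e_neg_one] at h1
  rw [omegaB_mass h C mN mP hax, omegaB_top h C mN mP hax] at h0 h1
  have hb0 := omegaB_boxSum h C mN mP 0
  have hb1 := omegaB_boxSum h C mN mP (Pi.single 0 1)
  rw [← hω] at hb0 hb1
  have hre : ((C.wch mN mP eWord : GaussianInt) : ℂ).re = ((C.wch mN mP eWord).re : ℝ) :=
    (GaussianInt.intCast_re _).symm
  have him : ((C.wch mN mP eWord : GaussianInt) : ℂ).im = ((C.wch mN mP eWord).im : ℝ) :=
    (GaussianInt.intCast_im _).symm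
  have h1' : 32 * PhaseTorus.boxSum ω (Pi.single 0 1) = 2 * (mass h C mN mP : ℝ) - ((C.wch mN mP eWord).im : ℝ) := by
    rw [h1, ← him]; simp
  rw [hre] at h0
  have eRe : ((C.wch mN mP eWord).re : ℝ) = ((2 * (mass h C mN mP - W h C mN mP 0) : ℤ) : ℝ) := by
    push_cast; linarith
  have eIm : ((C.wch mN mP eWord).im : ℝ) = ((2 * (mass h C mN mP - W h C mN mP (Pi.single 0 1)) : ℤ) : ℝ) := by
    push_cast; linarith
  exact Zsqrtd.ext (by exact_mod_cast eRe) (by exact_mod_cast eIm)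

/-- evenness of every factor makes a fourfold product divisible by `16`. -/
theorem sixteen_dvd_prod4 (g : Fin 4 → ℤ) (hg : ∀ f, 2 ∣ g f) : (16 : ℤ) ∣ ∏ f, g f := by
  rw [Fin.prod_univ_four, show (16 : ℤ) = 2 * 2 * 2 * 2 by norm_num]
  exact mul_dvd_mul (mul_dvd_mul (mul_dvd_mul (hg 0) (hg 1)) (hg 2)) (hg 3)

theorem sixteen_dvd_W (h : ℤ) (C : MConfig) (mN mP : MCell → ℤ)
    (hpar : ∀ Z ∈ C.lower ∪ C.upper, ∀ f, 2 ∣ defect h Z f) (s : Fin 4 → ZMod 4) : (16 : ℤ) ∣ W h C mN mP s := by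
  have hcell : ∀ Z ∈ C.lower ∪ C.upper, (16 : ℤ) ∣ ∏ f, (2 * babs Z f * pairI (s f) (tau Z f) + defect h Z f) :=
    fun Z hZ => sixteen_dvd_prod4 _ fun f => dvd_add (dvd_mul_of_dvd_left (dvd_mul_right 2 (babs Z f)) _) (hpar Z hZ f)
  unfold W
  refine dvd_sub (Finset.dvd_sum fun Z hZ => ?_) (Finset.dvd_sum fun P hP => ?_)
  · exact (hcell Z (Finset.mem_union_left _ hZ)).mul_left _
  · exact (hcell P (Finset.mem_union_right _ hP)).mul_left _

/-- the class-`2` identity: `2 M₀ = W(0) + W(2e₀)`. -/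
theorem two_mass_eq (h : ℤ) (C : MConfig) (mN mP : MCell → ℤ)
    (hax : ∀ Z ∈ C.lower ∪ C.upper, AxCell Z) (hA1 : ClassScreen (C.wch mN mP)) :
    2 * mass h C mN mP = W h C mN mP 0 + W h C mN mP (Pi.single 0 2) := by
  set ω := omegaB h C mN mP with hω
  have hK : ∀ k, PhaseTorus.KAdm k → k ≠ 0 → PhaseTorus.moment ω k = 0 :=
    fun k hk hk0 => omegaB_clean h C mN mP hax hA1 k hk hk0
  have h0 := PhaseTorus.boxLaw' ω hK 0
  have h2 := PhaseTorus.boxLaw' ω hK (Pi.single 0 2)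
  simp only [Pi.zero_apply, Finset.sum_const_zero, neg_zero, PhaseTorus.e_zero, one_mul] at h0
  have hs2 : ∑ f, (Pi.single (0 : Fin 4) (2 : ZMod 4) : Fin 4 → ZMod 4) f = 2 := by
    rw [Fin.sum_univ_four]; simp
  rw [hs2, show (-2 : ZMod 4) = 2 from by decide, PhaseTorus.e_two, neg_one_mul, Complex.neg_re] at h2
  rw [omegaB_mass h C mN mP hax] at h0 h2
  have hb0 := omegaB_boxSum h C mN mP 0
  have hb2 := omegaB_boxSum h C mN mP (Pi.single 0 2)
  rw [← hω] at hb0 hb2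
  have e : ((2 * mass h C mN mP : ℤ) : ℝ) = ((W h C mN mP 0 + W h C mN mP (Pi.single 0 2) : ℤ) : ℝ) := by
    push_cast; linarith
  exact_mod_cast e

/-- **THE BAND μ-LATTICE**: with even band defects, `16 ∣ re μ`, `16 ∣ im μ`, `32 ∣ re μ − im μ` (`μ ∈ 16(1+i)·ℤ[i]`) and `8 ∣ M₀`. -/
theorem axialDesign_mu_dvd (h : ℤ) (C : MConfig) (mN mP : MCell → ℤ)
    (hax : ∀ Z ∈ C.lower ∪ C.upper, AxCell Z) (hA1 : ClassScreen (C.wch mN mP))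
    (hpar : ∀ Z ∈ C.lower ∪ C.upper, ∀ f, 2 ∣ defect h Z f) :
    (16 : ℤ) ∣ (C.wch mN mP eWord).re ∧ (16 : ℤ) ∣ (C.wch mN mP eWord).im ∧
      (32 : ℤ) ∣ (C.wch mN mP eWord).re - (C.wch mN mP eWord).im ∧ (8 : ℤ) ∣ mass h C mN mP := by
  have hμ := axialDesign_mu_eq h C mN mP hax hA1
  have hM := two_mass_eq h C mN mP hax hA1
  have w0 := sixteen_dvd_W h C mN mP hpar 0
  have w1 := sixteen_dvd_W h C mN mP hpar (Pi.single 0 1)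
  have w2 := sixteen_dvd_W h C mN mP hpar (Pi.single 0 2)
  have hM8 : (8 : ℤ) ∣ mass h C mN mP := by
    have : (16 : ℤ) ∣ 2 * mass h C mN mP := by rw [hM]; exact dvd_add w0 w2
    omega
  rw [hμ]
  refine ⟨?_, ?_, ?_, hM8⟩
  · show (16 : ℤ) ∣ 2 * (mass h C mN mP - W h C mN mP 0)
    omega
  · show (16 : ℤ) ∣ 2 * (mass h C mN mP - W h C mN mP (Pi.single 0 1))
    omega
  · show (32 : ℤ) ∣ 2 * (mass h C mN mP - W h C mN mP 0) - 2 * (mass h C mN mP - W h C mN mP (Pi.single 0 1))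
    omega

/-! ## §2f the diamond `◇_h`: axial letters, even defects when `h` is even -/

theorem axis_of_inDiamond {h : ℤ} {x : BPoint} (hx : InDiamond h x) : x.2.1 = 0 ∨ x.2.2 = 0 := by
  rcases hx.1 with h0 | hax
  · left; exact (Prod.ext_iff.mp h0).1
  · rcases hax with ⟨-, h2⟩ | ⟨h1, -⟩
    · exact Or.inr h2
    · exact Or.inl h1

theorem absCharge_eq_babs {Z : MCell} {f : Fin 4} (hx : (Z f).2.1 = 0 ∨ (Z f).2.2 = 0) :
    absCharge (Z f) = babs Z f := by
  unfold absCharge chargeOf babs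
  rcases hx with h0 | h0 <;> rw [h0] <;> simp [abs_neg]

theorem defect_even_of_inDiamond {h : ℤ} (hh : 2 ∣ h) {Z : MCell} (hZ : MCell.InDiamond h Z) (f : Fin 4) :
    2 ∣ defect h Z f := by
  have hx := hZ f
  have hpar := hx.2.2.1
  rw [absCharge_eq_babs (axis_of_inDiamond hx)] at hpar
  unfold defect lineCharge
  omega

/-- **COROLLARY (◇_h, h even)**: every integer (A1)-clean design supported in `◇_h` has `μ ∈ 16(1+i)·ℤ[i]` and `8 ∣ M₀`. -/
theorem diamondDesign_mu_dvd (h : ℤ) (hh : 2 ∣ h) (C : MConfig) (mN mP : MCell → ℤ)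
    (hC : MConfig.InDiamond h C) (hA1 : ClassScreen (C.wch mN mP)) :
    (16 : ℤ) ∣ (C.wch mN mP eWord).re ∧ (16 : ℤ) ∣ (C.wch mN mP eWord).im ∧
      (32 : ℤ) ∣ (C.wch mN mP eWord).re - (C.wch mN mP eWord).im ∧ (8 : ℤ) ∣ mass h C mN mP := by
  have hD : ∀ Z ∈ C.lower ∪ C.upper, MCell.InDiamond h Z := fun Z hZ => by
    rcases Finset.mem_union.mp hZ with hZ | hZ
    · exact hC.1 Z hZ
    · exact hC.2 Z hZ
  exact axialDesign_mu_dvd h C mN mP (fun Z hZ => axCell_of_axis fun f => axis_of_inDiamond (hD Z hZ f)) hA1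
    fun Z hZ f => defect_even_of_inDiamond hh (hD Z hZ) f

end Summit.HodgeConjecture.HodgeConjecture.Cruxes.BlochSeedDiscOne.BandPhaseTorus
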